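import Summits.AtomisticToContinuum.FouriersLaw.Theses.PhononMeanFreePath
import Summits.AtomisticToContinuum.FouriersLaw.Theorems.PhononMeanFreePathDefs
import Summits.AtomisticToContinuum.FouriersLaw.Theorems.PhononMeanFreePathCoherentDephasingWeakCouplingIntegrability
import Summits.AtomisticToContinuum.FouriersLaw.Theorems.PhononMeanFreePathIncoherentChannelTwoHorizonsMean
import Summits.AtomisticToContinuum.FouriersLaw.Theorems.PhononMeanFreePathCoherentDephasingResponseRegularity

/-!
# `CoherentDephasing` from ONE time-moment of order `> 1` of the squared response, uniformly in the length
# (crux `PhononMeanFreePath.CoherentDephasing`, stmt-AtomisticToContinuum-11810; line `Sketch`, lead c2)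

The crux asks `N ∫₀^∞ r_N(t)² dt → 0` for the Gibbs- and noise-averaged end-to-end momentum response
`r_N(t) = ⟨p₀, K_t p_N⟩_{μ_T}` of the `(N+1)`-site pinned anharmonic chain between two Langevin baths at `T`.
Two `N`-UNIFORM facts about `r_N` are already theorems of this directory:

* the Landauer/dissipation bound `∫₀^∞ r_N(t)² dt ≤ T²/(2γ)` for every `N` (Bakry–Émery + Gaussian IBP,
  `Theorems/PhononMeanFreePathIncoherentBoundedCoherentLandauer.lean`) — the time-moment of order ZERO; and
* the sub-ballistic causal window `stub_lightCone` (p92940, line `two-horizons-forecast-loss` of the sibling crux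
  stmt-AtomisticToContinuum-11811): for every `0 < η < 1` there is `ε_N` with `N^{1+η} ε_N → 0` and `r_N(t)² ≤ ε_N` for
  `0 ≤ t ≤ N^η` (the far momentum does not feel the kick before the signal can arrive).

This file proves that ANY time-moment of order `a > 1`, bounded uniformly in `N`, closes the coherent channel:

* `coherentDephasing_of_timeWeightedResponse` —
  `(∀ params, ∃ a > 1, ∃ C, ∀ N R, 0 < R → ∫_{(0,R]} (1+t)^a r_N(t)² dt ≤ C) → CoherentDephasing`.
  Proof: split `(0,∞)` at the window `N^η` with `η = (a+1)/(2a) ∈ (1/a, 1)`; inside, the light cone gives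
  `N · N^η ε_N → 0`; beyond, `∫_{t > N^η} r_N² ≤ (1+N^η)^{-a} C ≤ C N^{-aη}` and `N^{1-aη} → 0` because `aη = (a+1)/2 > 1`
  (abstract two-horizons lemma `twoHorizons_tendsto_mul_integral_of_window_tail`). The hypothesis is stated with TRUNCATED
  integrals (the integrand is bounded by `(1+R)^a T²` and measurable there, so no Bochner junk value can satisfy it
  vacuously); integrability on `(0,∞)` with the same bound is DERIVED (`integrableOn_Ioi_of_truncated_le`).
* `coherentDephasing_of_timeWeightedResponse'` — the same with the improper integral and integrability as hypotheses.
* `coherentDephasing_of_responseEnvelope` — pointwise form: `r_N(t)² ≤ C (1+t)^{-s}` with `s > 2`, uniformly in `N`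
  (take `a = s/2`). The sibling reduction `coherentDephasing_of_forecastLoss` (p93383) assumed the same envelope for the
  much larger FORECAST NORM `S_N(t) = ‖K_t p_N‖²_{L²(μ_T)} ≥ r_N(t)²/T`; here only the pairing with `p₀` is needed.
* `coherentDephasing_of_timeWeightedCoherentEnergy` — the one-particle-sector ("coherent lifetime") form over the
  coherent-field vocabulary of line `Sketch`: `∃ a > 1, C, ∀ N R, ∫_{(0,R]} (1+t)^a Σ_x e_x^{(N)}(t) dt ≤ C`, where
  `e_x = cohEnergyDensity` is the harmonic energy density of the Gibbs-averaged linear response field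
  (`r_N² = m_N² ≤ 2 e_N ≤ 2 Σ_x e_x`).

So, along the time axis, the crux is EXACTLY the gap between the proved moment of order `0` (Landauer) and a moment of
order `> 1`: an `N`-uniform finite LIFETIME of the coherent response (thermal phonon lifetime), with the conversion of time
decay into the `o(1/N)` rate supplied by causality alone. The hypothesis is false at `lam = β = 0` (there
`∫₀^∞ r_N² → c_∞ > 0` while `r_N` lives at `t ≳ N`, so every moment of order `a > 0` diverges like `N^a`), consistent
with `HarmonicCoherentPersistence`; nothing here uses anharmonicity except through the hypothesis. Pure real analysis on
top of the landed theorems named above; no definition, no `sorry`, standard axioms.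
-/

noncomputable section

open MeasureTheory Set Filter Topology

namespace Summit.AtomisticToContinuum.FouriersLaw.Theorems.CoherentDephasing.TimeWeighted

open Literature.MathematicalPhysics.KineticTheory.HeatConduction (pinnedChain PhaseSpace)
open Summit.AtomisticToContinuum.FouriersLaw.Theses.PhononMeanFreePath (CoherentDephasing)
open Summit.AtomisticToContinuum.FouriersLaw.Theorems.PhononMeanFreePath
open Summit.AtomisticToContinuum.FouriersLaw.Theorems.CoherentDephasing.ResponseRegularity (stub_responseRegularity)

/-! ## Real-analysis toolkit (chain-independent) -/

/-- **From uniformly bounded truncated integrals to the improper integral.** If `g ≥ 0` on `(0,∞)` is integrable on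
every `(0,R]` with `∫_{(0,R]} g ≤ C`, then `g` is integrable on `(0,∞)` and `∫_{(0,∞)} g ≤ C` (monotone convergence
along `R = n+1`). [folklore] -/
theorem integrableOn_Ioi_of_truncated_le {g : ℝ → ℝ} {C : ℝ} (hg0 : ∀ t, 0 < t → 0 ≤ g t)
    (hgi : ∀ R : ℝ, 0 < R → IntegrableOn g (Ioc 0 R))
    (hle : ∀ R : ℝ, 0 < R → ∫ t in Ioc 0 R, g t ≤ C) :
    IntegrableOn g (Ioi 0) ∧ ∫ t in Ioi 0, g t ≤ C := by
  have hpos : ∀ n : ℕ, (0 : ℝ) < (n : ℝ) + 1 := fun n => by positivity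
  have hfi : ∀ n : ℕ, IntegrableOn g (Ioc 0 ((n : ℝ) + 1)) := fun n => hgi _ (hpos n)
  have hb : Tendsto (fun n : ℕ => (n : ℝ) + 1) atTop atTop :=
    tendsto_atTop_add_const_right _ _ tendsto_natCast_atTop_atTop
  -- the interval integrals of `‖g‖ = g` are the truncated integrals
  have hnorm : ∀ n : ℕ, ∫ x in (0 : ℝ)..((n : ℝ) + 1), ‖g x‖ = ∫ t in Ioc 0 ((n : ℝ) + 1), g t := by
    intro n
    rw [intervalIntegral.integral_of_le (hpos n).le]
    refine setIntegral_congr_fun measurableSet_Ioc fun t ht => ?_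
    rw [Real.norm_eq_abs, abs_of_nonneg (hg0 t ht.1)]
  have hval : ∀ n : ℕ, ∫ x in (0 : ℝ)..((n : ℝ) + 1), g x = ∫ t in Ioc 0 ((n : ℝ) + 1), g t := fun n =>
    intervalIntegral.integral_of_le (hpos n).le
  have hI : IntegrableOn g (Ioi 0) :=
    integrableOn_Ioi_of_intervalIntegral_norm_bounded C 0 hfi hb
      (Eventually.of_forall fun n => (hnorm n).le.trans (hle _ (hpos n)))
  refine ⟨hI, ?_⟩
  have ht := intervalIntegral_tendsto_integral_Ioi 0 hI hb
  exact le_of_tendsto' ht fun n => (hval n).le.trans (hle _ (hpos n))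

/-- **Tail of a non-negative function from a weighted integral bound**: if `f ≥ 0` on `(0,∞)`, `f` and
`(1+t)^a f` are integrable there and `∫_{(0,∞)} (1+t)^a f ≤ C` (`a ≥ 0`), then for every `A ≥ 0`,
`∫_{(A,∞)} f ≤ (1+A)^{-a} C`. [folklore] -/
theorem setIntegral_Ioi_le_of_weighted {f : ℝ → ℝ} {a C A : ℝ} (ha : 0 ≤ a) (hA : 0 ≤ A)
    (hf0 : ∀ t, 0 < t → 0 ≤ f t) (hfi : IntegrableOn f (Ioi 0))
    (hwi : IntegrableOn (fun t => (1 + t) ^ a * f t) (Ioi 0))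
    (hle : ∫ t in Ioi 0, (1 + t) ^ a * f t ≤ C) :
    ∫ t in Ioi A, f t ≤ (1 + A) ^ (-a) * C := by
  have hA1 : 0 < 1 + A := by linarith
  have hsub : Ioi A ⊆ Ioi (0 : ℝ) := Ioi_subset_Ioi hA
  have hwA : IntegrableOn (fun t => (1 + t) ^ a * f t) (Ioi A) := hwi.mono_set hsub
  -- pointwise: `f t ≤ (1+A)^{-a} (1+t)^a f t` on `t > A`
  have hpt : ∀ t ∈ Ioi A, f t ≤ (1 + A) ^ (-a) * ((1 + t) ^ a * f t) := by
    intro t ht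
    have htA : A < t := ht
    have ht0 : 0 < t := lt_of_le_of_lt hA htA
    have h1t : 0 < 1 + t := by linarith
    have hft : 0 ≤ f t := hf0 t ht0
    -- `(1+A)^{-a} (1+t)^a ≥ (1+t)^{-a} (1+t)^a = 1`
    have hmono : (1 + t) ^ (-a) ≤ (1 + A) ^ (-a) :=
      Real.rpow_le_rpow_of_nonpos hA1 (by linarith) (by linarith)
    have hone : (1 + t) ^ (-a) * (1 + t) ^ a = 1 := by
      rw [← Real.rpow_add h1t, neg_add_cancel, Real.rpow_zero]
    calc f t = (1 + t) ^ (-a) * ((1 + t) ^ a * f t) := by rw [← mul_assoc, hone, one_mul]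
      _ ≤ (1 + A) ^ (-a) * ((1 + t) ^ a * f t) :=
          mul_le_mul_of_nonneg_right hmono (mul_nonneg (Real.rpow_nonneg h1t.le _) hft)
  calc ∫ t in Ioi A, f t ≤ ∫ t in Ioi A, (1 + A) ^ (-a) * ((1 + t) ^ a * f t) :=
        setIntegral_mono_on (hfi.mono_set hsub) (hwA.const_mul _) measurableSet_Ioi hpt
    _ = (1 + A) ^ (-a) * ∫ t in Ioi A, (1 + t) ^ a * f t := integral_const_mul _ _
    _ ≤ (1 + A) ^ (-a) * ∫ t in Ioi 0, (1 + t) ^ a * f t := by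
        refine mul_le_mul_of_nonneg_left ?_ (Real.rpow_nonneg hA1.le _)
        refine setIntegral_mono_set hwi ?_ (Eventually.of_forall hsub)
        filter_upwards [ae_restrict_mem measurableSet_Ioi] with t ht
        have ht0 : (0 : ℝ) < t := ht
        exact mul_nonneg (Real.rpow_nonneg (by linarith) _) (hf0 t ht0)
    _ ≤ (1 + A) ^ (-a) * C := mul_le_mul_of_nonneg_left hle (Real.rpow_nonneg hA1.le _)

/-- A bounded measurable function times the weight `(1+t)^a` (`a ≥ 0`) is integrable on every `(0,R]`. [folklore] -/
theorem integrableOn_Ioc_weighted_of_bounded {f : ℝ → ℝ} {a M R : ℝ} (ha : 0 ≤ a)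
    (hfm : Measurable f) (hfb : ∀ t, |f t| ≤ M) :
    IntegrableOn (fun t => (1 + t) ^ a * f t) (Ioc 0 R) := by
  have hmeas : Measurable (fun t : ℝ => (1 + t) ^ a * f t) :=
    ((measurable_const.add measurable_id).pow_const a).mul hfm
  refine Measure.integrableOn_of_bounded (M := (1 + |R|) ^ a * |M|) measure_Ioc_lt_top.ne
    hmeas.aestronglyMeasurable ?_
  filter_upwards [ae_restrict_mem measurableSet_Ioc] with t ht
  have ht0 : 0 < t := ht.1
  have htR : t ≤ R := ht.2
  have h1t : 0 ≤ 1 + t := by linarith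
  rw [norm_mul, Real.norm_eq_abs, Real.norm_eq_abs, abs_of_nonneg (Real.rpow_nonneg h1t _)]
  refine mul_le_mul (Real.rpow_le_rpow h1t (by linarith [le_abs_self R]) ha) ((hfb t).trans (le_abs_self M))
    (abs_nonneg _) (Real.rpow_nonneg (by linarith [abs_nonneg R]) _)

/-! ## The reductions -/

/-- **`CoherentDephasing` from an `N`-uniform time-moment of order `> 1` of the squared end-to-end response.**
If for every admissible parameter point there are `a > 1` and `C` with
`∫_{(0,R]} (1+t)^a r_N(t)² dt ≤ C` for every length `N` and every `R > 0` (`r_N = pairCorr … N`), then the route's crux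
`CoherentDephasing` holds BY NAME: the landed sub-ballistic light cone `stub_lightCone` (causal window `t ≤ N^η`,
`η = (a+1)/(2a)`) and the weighted tail `∫_{t > N^η} r_N² ≤ C N^{-aη}`, `aη > 1`, feed the abstract two-horizons lemma.
[folklore] -/
theorem coherentDephasing_of_timeWeightedResponse :
    (∀ ω₂ lam β γ : ℝ, 0 < ω₂ → 0 < lam → 0 < β → 0 < γ → ∀ T : ℝ, 0 < T →
      ∃ a C : ℝ, 1 < a ∧ ∀ (N : ℕ) (R : ℝ), 0 < R →
        ∫ t in Set.Ioc 0 R, (1 + t) ^ a * (pairCorr ω₂ lam β γ T N t) ^ 2 ≤ C) →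
    Summit.AtomisticToContinuum.FouriersLaw.Theses.PhononMeanFreePath.CoherentDephasing := by
  intro h
  rw [coherentDephasing_iff_limit]
  intro ω₂ lam β γ hω hl hβ hγ T hT
  obtain ⟨a, C, ha1, hC⟩ := h ω₂ lam β γ hω hl hβ hγ T hT
  have ha0 : 0 ≤ a := by linarith
  -- the response and its `N`-uniform a-priori facts
  set r : ℕ → ℝ → ℝ := fun N t => pairCorr ω₂ lam β γ T N t with hr
  have hmeas : ∀ N, Measurable (r N) := fun N =>
    pinnedChain_measurable_pairCorr hω hl.le hβ hγ hT 0 (Fin.last N)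
  have habs : ∀ N t, |r N t| ≤ T := fun N t => abs_pairCorr_last_le_temp hω hl.le hβ hγ hT N t
  have hint : ∀ N, IntegrableOn (fun t => r N t ^ 2) (Ioi 0) := fun N =>
    pairCorr_sq_integrableOn hω hl.le hβ hγ hT N
  have hsqm : ∀ N, Measurable fun t => r N t ^ 2 := fun N => (hmeas N).pow_const 2
  have hsqb : ∀ N t, |r N t ^ 2| ≤ T ^ 2 := fun N t => by
    rw [abs_of_nonneg (sq_nonneg _), ← sq_abs]
    exact pow_le_pow_left₀ (abs_nonneg _) (habs N t) 2
  -- the weighted square: non-negative, integrable on truncations, hence on `(0,∞)` with the same bound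
  have hg0 : ∀ (N : ℕ) (t : ℝ), 0 < t → 0 ≤ (1 + t) ^ a * r N t ^ 2 := fun N t ht =>
    mul_nonneg (Real.rpow_nonneg (by linarith) _) (sq_nonneg _)
  have hgi : ∀ (N : ℕ) (R : ℝ), 0 < R → IntegrableOn (fun t => (1 + t) ^ a * r N t ^ 2) (Ioc 0 R) :=
    fun N R _ => integrableOn_Ioc_weighted_of_bounded ha0 (hsqm N) (hsqb N)
  have hwI : ∀ N, IntegrableOn (fun t => (1 + t) ^ a * r N t ^ 2) (Ioi 0) ∧
      ∫ t in Ioi 0, (1 + t) ^ a * r N t ^ 2 ≤ C := fun N =>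
    integrableOn_Ioi_of_truncated_le (hg0 N) (hgi N) fun R hR => hC N R hR
  have hC0 : 0 ≤ C :=
    le_trans (setIntegral_nonneg measurableSet_Ioi fun t ht => hg0 0 t ht) (hwI 0).2
  -- the window exponent `η ∈ (1/a, 1)`
  set η : ℝ := (a + 1) / (2 * a) with hηdef
  have hapos : 0 < a := by linarith
  have hη0 : 0 < η := by rw [hηdef]; positivity
  have hη1 : η < 1 := by rw [hηdef, div_lt_one (by positivity)]; linarith
  have haη : a * η = (a + 1) / 2 := by rw [hηdef]; field_simp
  have haη1 : 1 < a * η := by rw [haη]; linarith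
  obtain ⟨ε, hε, hwin⟩ := stub_lightCone ω₂ lam β γ hω hl hβ hγ T hT η hη0 hη1
  -- two horizons
  have hmain : Tendsto (fun N : ℕ => (N : ℝ) * ∫ t in Ioi (0 : ℝ), r N t ^ 2) atTop (𝓝 0) := by
    refine twoHorizons_tendsto_mul_integral_of_window_tail (f := fun N t => r N t ^ 2)
      (a := fun N => (N : ℝ) ^ η) (w := ε) (b := fun N => C * (N : ℝ) ^ (1 - a * η))
      (fun N => Real.rpow_nonneg (Nat.cast_nonneg N) η) hint ?_ ?_ ?_ ?_
    · -- inside the causal window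
      intro N t ht htN
      have h1 := hwin N t ht.le htN
      rw [abs_of_nonneg (sq_nonneg _)]
      linarith [abs_nonneg (commonPast ω₂ lam β γ T N t)]
    · -- beyond the window: the weighted tail, for `N ≥ 1`
      filter_upwards [eventually_ge_atTop 1] with N hN
      have hN0 : (0 : ℝ) < N := by exact_mod_cast hN
      have hNη : 0 < (N : ℝ) ^ η := Real.rpow_pos_of_pos hN0 η
      have htail := setIntegral_Ioi_le_of_weighted ha0 hNη.le (fun t _ => sq_nonneg (r N t)) (hint N)
        (hwI N).1 (hwI N).2
      have habs' : ∫ t in Ioi ((N : ℝ) ^ η), |r N t ^ 2| = ∫ t in Ioi ((N : ℝ) ^ η), r N t ^ 2 :=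
        integral_congr_ae (Eventually.of_forall fun t => abs_of_nonneg (sq_nonneg _))
      rw [habs']
      -- `(1 + N^η)^{-a} ≤ (N^η)^{-a} = N^{-aη}`
      have hcmp : (1 + (N : ℝ) ^ η) ^ (-a) ≤ (N : ℝ) ^ (-(a * η)) := by
        have h1 : (1 + (N : ℝ) ^ η) ^ (-a) ≤ ((N : ℝ) ^ η) ^ (-a) :=
          Real.rpow_le_rpow_of_nonpos hNη (by linarith) (by linarith)
        rw [← Real.rpow_mul hN0.le, show η * -a = -(a * η) by ring] at h1
        exact h1
      calc (N : ℝ) * ∫ t in Ioi ((N : ℝ) ^ η), r N t ^ 2 ≤ (N : ℝ) * ((1 + (N : ℝ) ^ η) ^ (-a) * C) :=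
            mul_le_mul_of_nonneg_left htail hN0.le
        _ ≤ (N : ℝ) * ((N : ℝ) ^ (-(a * η)) * C) :=
            mul_le_mul_of_nonneg_left (mul_le_mul_of_nonneg_right hcmp hC0) hN0.le
        _ = C * ((N : ℝ) ^ (1 : ℝ) * (N : ℝ) ^ (-(a * η))) := by rw [Real.rpow_one]; ring
        _ = C * (N : ℝ) ^ (1 - a * η) := by
            rw [← Real.rpow_add hN0, show (1 : ℝ) + -(a * η) = 1 - a * η by ring]
    · -- window mass: `N · (ε_N · N^η) = N^{1+η} ε_N → 0`
      refine hε.congr fun N => ?_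
      rw [Real.rpow_add' (Nat.cast_nonneg N) (by linarith : (1 : ℝ) + η ≠ 0), Real.rpow_one]
      ring
    · -- tail mass: `C N^{1-aη} → 0`
      have := (twoHorizons_tendsto_natCast_rpow_of_neg (show 1 - a * η < 0 by linarith)).const_mul C
      rwa [mul_zero] at this
  simpa only [hr, pairCorr, fcast] using hmain

/-- **Improper-integral form.** If for every admissible parameter point there are `a > 1` and `C` such that for every
`N` the weighted square `t ↦ (1+t)^a r_N(t)²` is integrable on `(0,∞)` with integral `≤ C`, then `CoherentDephasing`
holds (truncated integrals of a non-negative integrable function are bounded by the full one). [folklore] -/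
theorem coherentDephasing_of_timeWeightedResponse' :
    (∀ ω₂ lam β γ : ℝ, 0 < ω₂ → 0 < lam → 0 < β → 0 < γ → ∀ T : ℝ, 0 < T →
      ∃ a C : ℝ, 1 < a ∧ ∀ N : ℕ,
        MeasureTheory.IntegrableOn (fun t : ℝ => (1 + t) ^ a * (pairCorr ω₂ lam β γ T N t) ^ 2) (Set.Ioi 0) ∧
          ∫ t in Set.Ioi (0 : ℝ), (1 + t) ^ a * (pairCorr ω₂ lam β γ T N t) ^ 2 ≤ C) →
    Summit.AtomisticToContinuum.FouriersLaw.Theses.PhononMeanFreePath.CoherentDephasing := by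
  intro h
  refine coherentDephasing_of_timeWeightedResponse fun ω₂ lam β γ hω hl hβ hγ T hT => ?_
  obtain ⟨a, C, ha1, hC⟩ := h ω₂ lam β γ hω hl hβ hγ T hT
  refine ⟨a, C, ha1, fun N R hR => ?_⟩
  obtain ⟨hI, hle⟩ := hC N
  refine le_trans (setIntegral_mono_set hI ?_ (Eventually.of_forall Ioc_subset_Ioi_self)) hle
  filter_upwards [ae_restrict_mem measurableSet_Ioi] with t ht
  have ht0 : (0 : ℝ) < t := ht
  exact mul_nonneg (Real.rpow_nonneg (by linarith) _) (sq_nonneg _)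

/-- **Pointwise-envelope form.** If for every admissible parameter point there are `C` and `s > 2` with
`r_N(t)² ≤ C (1+t)^{-s}` for all `N` and all `t ≥ 0`, then `CoherentDephasing` holds: with `a = s/2 ∈ (1, s-1)` the
weighted square is dominated by `|C| (1+t)^{-s/2} ∈ L¹(0,∞)`. (The sibling `coherentDephasing_of_forecastLoss` assumed this
envelope for the forecast norm `S_N(t) ≥ r_N(t)²/T`.) [folklore] -/
theorem coherentDephasing_of_responseEnvelope :
    (∀ ω₂ lam β γ : ℝ, 0 < ω₂ → 0 < lam → 0 < β → 0 < γ → ∀ T : ℝ, 0 < T →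
      ∃ C s : ℝ, 2 < s ∧ ∀ (N : ℕ) (t : ℝ), 0 ≤ t → (pairCorr ω₂ lam β γ T N t) ^ 2 ≤ C * (1 + t) ^ (-s)) →
    Summit.AtomisticToContinuum.FouriersLaw.Theses.PhononMeanFreePath.CoherentDephasing := by
  intro h
  refine coherentDephasing_of_timeWeightedResponse fun ω₂ lam β γ hω hl hβ hγ T hT => ?_
  obtain ⟨C, s, hs2, hC⟩ := h ω₂ lam β γ hω hl hβ hγ T hT
  have hs1 : 1 < s / 2 := by linarith
  -- the dominating function and its integral
  have hdomI : IntegrableOn (fun t : ℝ => |C| * (1 + t) ^ (-(s / 2))) (Ioi 0) :=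
    (twoHorizons_integrableOn_one_add_rpow_neg hs1).const_mul |C|
  refine ⟨s / 2, ∫ t in Ioi (0 : ℝ), |C| * (1 + t) ^ (-(s / 2)), hs1, fun N R hR => ?_⟩
  have hmeas : Measurable fun t => pairCorr ω₂ lam β γ T N t :=
    pinnedChain_measurable_pairCorr hω hl.le hβ hγ hT 0 (Fin.last N)
  have hsqb : ∀ t, |pairCorr ω₂ lam β γ T N t ^ 2| ≤ T ^ 2 := fun t => by
    rw [abs_of_nonneg (sq_nonneg _), ← sq_abs]
    exact pow_le_pow_left₀ (abs_nonneg _) (abs_pairCorr_last_le_temp hω hl.le hβ hγ hT N t) 2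
  have hgi : IntegrableOn (fun t => (1 + t) ^ (s / 2) * pairCorr ω₂ lam β γ T N t ^ 2) (Ioc 0 R) :=
    integrableOn_Ioc_weighted_of_bounded (by linarith) (hmeas.pow_const 2) hsqb
  -- pointwise domination on `(0,R]`
  have hpt : ∀ t ∈ Ioc (0 : ℝ) R,
      (1 + t) ^ (s / 2) * pairCorr ω₂ lam β γ T N t ^ 2 ≤ |C| * (1 + t) ^ (-(s / 2)) := by
    intro t ht
    have ht0 : 0 < t := ht.1
    have h1t : 0 < 1 + t := by linarith
    have h1 := hC N t ht0.le
    have hw0 : 0 ≤ (1 + t) ^ (s / 2) := Real.rpow_nonneg h1t.le _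
    calc (1 + t) ^ (s / 2) * pairCorr ω₂ lam β γ T N t ^ 2 ≤ (1 + t) ^ (s / 2) * (C * (1 + t) ^ (-s)) :=
          mul_le_mul_of_nonneg_left h1 hw0
      _ ≤ (1 + t) ^ (s / 2) * (|C| * (1 + t) ^ (-s)) :=
          mul_le_mul_of_nonneg_left (mul_le_mul_of_nonneg_right (le_abs_self C) (Real.rpow_nonneg h1t.le _)) hw0
      _ = |C| * ((1 + t) ^ (s / 2) * (1 + t) ^ (-s)) := by ring
      _ = |C| * (1 + t) ^ (-(s / 2)) := by
          rw [← Real.rpow_add h1t]; congr 1; congr 1; ring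
  calc ∫ t in Ioc 0 R, (1 + t) ^ (s / 2) * pairCorr ω₂ lam β γ T N t ^ 2
      ≤ ∫ t in Ioc 0 R, |C| * (1 + t) ^ (-(s / 2)) :=
        setIntegral_mono_on hgi (hdomI.mono_set Ioc_subset_Ioi_self) measurableSet_Ioc hpt
    _ ≤ ∫ t in Ioi (0 : ℝ), |C| * (1 + t) ^ (-(s / 2)) := by
        refine setIntegral_mono_set hdomI ?_ (Eventually.of_forall Ioc_subset_Ioi_self)
        filter_upwards [ae_restrict_mem measurableSet_Ioi] with t ht
        have ht0 : (0 : ℝ) < t := ht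
        exact mul_nonneg (abs_nonneg C) (Real.rpow_nonneg (by linarith) _)

/-! ## The coherent-lifetime form over the vocabulary of line `Sketch` -/

/-- The coherent site energy density `t ↦ e_x(t)` is continuous (fixed `N`; from `stub_responseRegularity`). [folklore] -/
theorem continuous_cohEnergyDensity {ω₂ lam β γ : ℝ} (hω : 0 < ω₂) (hl : 0 < lam) (hβ : 0 < β) (hγ : 0 < γ)
    {T : ℝ} (hT : 0 < T) (N : ℕ) (x : Fin (N + 1)) :
    Continuous (cohEnergyDensity ω₂ lam β γ T N x) := by
  obtain ⟨hcont, -, -, -⟩ := stub_responseRegularity ω₂ lam β γ hω hl hβ hγ T hT N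
  have hm : ∀ y, Continuous (momResp ω₂ lam β γ T N y) := fun y => (hcont y).1
  have hn : ∀ y, Continuous (posResp ω₂ lam β γ T N y) := fun y => (hcont y).2.1
  unfold cohEnergyDensity
  refine ((((hm x).pow 2).add (((hn x).pow 2).const_mul ω₂)).div_const 2).add
    ((continuous_finsetSum _ fun b _ => ?_).const_mul (1 / 4))
  by_cases hb : (b : ℕ) = (x : ℕ) ∨ (b : ℕ) + 1 = (x : ℕ)
  · simp only [if_pos hb]
    exact ((hn _).sub (hn _)).pow 2
  · simp only [if_neg hb]
    exact continuous_const

/-- `m_x(t)² ≤ 2 e_x(t)` pointwise (`ω₂ ≥ 0`). [folklore] -/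
theorem momResp_sq_le_two_mul_cohEnergyDensity {ω₂ : ℝ} (lam β γ T : ℝ) (hω : 0 ≤ ω₂) (N : ℕ)
    (x : Fin (N + 1)) (t : ℝ) :
    momResp ω₂ lam β γ T N x t ^ 2 ≤ 2 * cohEnergyDensity ω₂ lam β γ T N x t := by
  unfold cohEnergyDensity
  have h1 : 0 ≤ ω₂ * posResp ω₂ lam β γ T N x t ^ 2 := by positivity
  have h2 : 0 ≤ ∑ b : Fin N, (if (b : ℕ) = (x : ℕ) ∨ (b : ℕ) + 1 = (x : ℕ) then
      (posResp ω₂ lam β γ T N b.succ t - posResp ω₂ lam β γ T N b.castSucc t) ^ 2 else 0) :=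
    Finset.sum_nonneg fun b _ => by split_ifs <;> positivity
  nlinarith

/-- **`CoherentDephasing` from an `N`-uniform time-moment of order `> 1` of the TOTAL coherent energy** (the
one-particle-sector / coherent-lifetime form along line `Sketch`). If for every admissible parameter point there are
`a > 1` and `C` with `∫_{(0,R]} (1+t)^a Σ_{x ≤ N} e_x^{(N)}(t) dt ≤ C` for every `N` and `R > 0`
(`e_x = cohEnergyDensity`, the harmonic energy density of the Gibbs-averaged linear response field; physically
`Σ_x e_x(t) ≈ (T²/2) e^{-Γt}` with `Γ` the thermal phonon damping rate, so any `a` works, while harmonically the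
coherent energy leaves only through the baths over times `≳ N`), then `CoherentDephasing` holds, because
`r_N² = m_N² ≤ 2 e_N ≤ 2 Σ_x e_x`. [folklore] -/
theorem coherentDephasing_of_timeWeightedCoherentEnergy :
    (∀ ω₂ lam β γ : ℝ, 0 < ω₂ → 0 < lam → 0 < β → 0 < γ → ∀ T : ℝ, 0 < T →
      ∃ a C : ℝ, 1 < a ∧ ∀ (N : ℕ) (R : ℝ), 0 < R →
        ∫ t in Set.Ioc 0 R, (1 + t) ^ a * ∑ x : Fin (N + 1), cohEnergyDensity ω₂ lam β γ T N x t ≤ C) →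
    Summit.AtomisticToContinuum.FouriersLaw.Theses.PhononMeanFreePath.CoherentDephasing := by
  intro h
  refine coherentDephasing_of_timeWeightedResponse fun ω₂ lam β γ hω hl hβ hγ T hT => ?_
  obtain ⟨a, C, ha1, hC⟩ := h ω₂ lam β γ hω hl hβ hγ T hT
  refine ⟨a, 2 * C, ha1, fun N R hR => ?_⟩
  have ha0 : 0 ≤ a := by linarith
  -- integrability of both weighted integrands on `(0,R]`
  have hmeas : Measurable fun t => pairCorr ω₂ lam β γ T N t :=
    pinnedChain_measurable_pairCorr hω hl.le hβ hγ hT 0 (Fin.last N)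
  have hsqb : ∀ t, |pairCorr ω₂ lam β γ T N t ^ 2| ≤ T ^ 2 := fun t => by
    rw [abs_of_nonneg (sq_nonneg _), ← sq_abs]
    exact pow_le_pow_left₀ (abs_nonneg _) (abs_pairCorr_last_le_temp hω hl.le hβ hγ hT N t) 2
  have hgi : IntegrableOn (fun t => (1 + t) ^ a * pairCorr ω₂ lam β γ T N t ^ 2) (Ioc 0 R) :=
    integrableOn_Ioc_weighted_of_bounded ha0 (hmeas.pow_const 2) hsqb
  have hEc : Continuous fun t => (1 + t) ^ a * ∑ x : Fin (N + 1), cohEnergyDensity ω₂ lam β γ T N x t :=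
    ((continuous_const.add continuous_id).rpow_const fun _ => Or.inr ha0).mul
      (continuous_finsetSum _ fun x _ => continuous_cohEnergyDensity hω hl hβ hγ hT N x)
  have hEi : IntegrableOn (fun t => (1 + t) ^ a * ∑ x : Fin (N + 1), cohEnergyDensity ω₂ lam β γ T N x t)
      (Ioc 0 R) := hEc.integrableOn_Ioc
  -- pointwise comparison
  have hpt : ∀ t ∈ Ioc (0 : ℝ) R, (1 + t) ^ a * pairCorr ω₂ lam β γ T N t ^ 2 ≤
      2 * ((1 + t) ^ a * ∑ x : Fin (N + 1), cohEnergyDensity ω₂ lam β γ T N x t) := by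
    intro t ht
    have h1t : 0 ≤ 1 + t := by linarith [ht.1]
    have hw0 : 0 ≤ (1 + t) ^ a := Real.rpow_nonneg h1t _
    have hr : pairCorr ω₂ lam β γ T N t ^ 2 ≤ 2 * cohEnergyDensity ω₂ lam β γ T N (Fin.last N) t := by
      rw [← momResp_last_eq_pairCorr]
      exact momResp_sq_le_two_mul_cohEnergyDensity lam β γ T hω.le N (Fin.last N) t
    have hlast : cohEnergyDensity ω₂ lam β γ T N (Fin.last N) t ≤
        ∑ x : Fin (N + 1), cohEnergyDensity ω₂ lam β γ T N x t :=
      Finset.single_le_sum (f := fun x => cohEnergyDensity ω₂ lam β γ T N x t)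
        (fun x _ => cohEnergyDensity_nonneg ω₂ lam β γ T N hω.le x t) (Finset.mem_univ _)
    nlinarith
  calc ∫ t in Ioc 0 R, (1 + t) ^ a * pairCorr ω₂ lam β γ T N t ^ 2
      ≤ ∫ t in Ioc 0 R, 2 * ((1 + t) ^ a * ∑ x : Fin (N + 1), cohEnergyDensity ω₂ lam β γ T N x t) :=
        setIntegral_mono_on hgi (hEi.const_mul 2) measurableSet_Ioc hpt
    _ = 2 * ∫ t in Ioc 0 R, (1 + t) ^ a * ∑ x : Fin (N + 1), cohEnergyDensity ω₂ lam β γ T N x t :=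
        integral_const_mul _ _
    _ ≤ 2 * C := by linarith [hC N R hR]

end Summit.AtomisticToContinuum.FouriersLaw.Theorems.CoherentDephasing.TimeWeighted

end
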